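import Summits.RiemannHypothesis.RiemannHypothesis.Theorems.GroundBartaPolarPerronFrobeniusGroundFold
import Summits.RiemannHypothesis.RiemannHypothesis.Theorems.WeilWindowFlowWindowLipschitzStubFormDomainPos
import Summits.RiemannHypothesis.RiemannHypothesis.Theorems.WeilWindowFlowWindowLipschitzStubGroundStateEnergy
import HarnessLib

/-!
# RiemannHypothesis / GroundBarta — crux `PolarPerronFrobenius` (stmt-RiemannHypothesis-18390):
# the GROUND-STATE SOURCE CRITERION (part G2): a real ground state whose source is positive on its
# negative set is non-negative

Helper file (`--supports stmt-RiemannHypothesis-18390`), RH-free, Mathlib + proved tree files only,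
no definitions, no named facts.

For a REAL ground state `u` of the full windowed Weil form at the window `a` (`IsWeilGroundState a u`,
`u : ℝ → ℝ` measurable) define its SOURCE at `y` (jump form: `w = weilArchDensity`, prime rates
`Λ(n)n^{-1/2}`, `log n < 2a`; `u⁺ = max(u,0)`)

  `S_u(y) = ∫_{(0,∞)} w(t)(u⁺(y+t) + u⁺(y−t)) dt + Σ_n Λ(n)n^{-1/2}(u⁺(y+log n) + u⁺(y−log n))
            − 2∫ u⁺(x)cosh((x−y)/2) dx`.

**Theorem (`swg_ae_nonneg_of_source_pos`).**  If `S_u(y) > 0` for a.e. `y` with `u(y) < 0`, then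
`u ≥ 0` a.e.; in particular (`swg_GSP_of_source_pos`) the window `a` carries a real non-negative ground
state (`GSP a`, the conclusion of the crux's matrix).

Proof (form domain, no Euler–Lagrange equation, no coercivity constant, kernel NOT truncated).  By the
landed form-domain theorems of route WeilWindowFlow (`stub_groundStateEnergy`: a ground state has finite
energy and `P(u) + 𝓔_a(u) ≤ (M_a + ε(a))‖u‖²`; `stub_formDomainPos`: `(M_a + ε(a))‖v‖² ≤ P(v) + 𝓔_a(v)`
for every finite-energy `v ∈ L²` on the window) applied to `u` and to `v = |u|` (finite energy by the
Markov property, `finiteEnergy_norm`), `P(|u|) + 𝓔_a(|u|) ≥ P(u) + 𝓔_a(u)`.  On the other hand the fold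
identities (`…GroundFold.lean` for increments and pole form; Tonelli for the untruncated archimedean
gain, `swg_archGain_eq`) give `P(|u|) + 𝓔_a(|u|) = P(u) + 𝓔_a(u) − 4∫ u⁻ S_u`.  Hence `∫ u⁻S_u ≤ 0`,
while `u⁻ S_u ≥ 0` a.e.; so `u⁻ S_u = 0` a.e. and `u⁻ = 0` a.e.

This is the ground-state form of the harmonic-majorant card's `edgeLayerCriterion`
(`Cruxes/PolarPerronFrobenius/Ideas/harmonic-majorant-edge-source.md`): bulk sign, layer structure and
coercivity are all absorbed into the single hypothesis `S_u > 0` on `{u < 0}` (on the bulk part of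
`{u<0}` — empty under the card's bulk-shape input — nothing is asked; on the edge layer `S_u` is the
card's source with the full capacity term).

Prover B, speedrun unit `sr-gb-rung-b` (seat 2).
-/

set_option linter.dupNamespace false

noncomputable section

open Set MeasureTheory Filter Complex
open scoped Real Topology

namespace Summit.RiemannHypothesis.RiemannHypothesis.Theorems.PolarPerronFrobenius

open Literature.NumberTheory.LFunctions
open Summit.RiemannHypothesis.RiemannHypothesis.Theorems.WeilGroundStateMarkovPart
open Summit.RiemannHypothesis.RiemannHypothesis.Theorems.WeilWindowFlowWindowLipschitz
open scoped ArithmeticFunction.vonMangoldt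

/-! ## Tonelli for the untruncated archimedean gain of an `L²` function -/

section Tonelli

variable {u : ℝ → ℝ} {a : ℝ}

/-- **The archimedean gain of the fold, `L²` version (Tonelli).**  For a real measurable `u ∈ L²`
whose complexification and modulus have finite archimedean energy,
`∫_{(0,∞)} w (D_t u − D_t|u|) dt = 4∫ u⁻(x) (∫_{(0,∞)} w(t)(u⁺(x+t) + u⁺(x−t)) dt) dx`,
and the `x`-integrand is integrable. [folklore] -/
theorem swg_archGain_eq (hum : Measurable u) (hu : MemLp u 2 volume)
    (hE : IntegrableOn (fun t ↦ weilArchDensity t * weilIncrement (fun x ↦ ((u x : ℝ) : ℂ)) t) (Ioi 0))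
    (hEA : IntegrableOn (fun t ↦ weilArchDensity t * weilIncrement (fun x ↦ ((|u x| : ℝ) : ℂ)) t) (Ioi 0)) :
    (∫ t in Ioi (0 : ℝ), weilArchDensity t *
        (weilIncrement (fun x ↦ ((u x : ℝ) : ℂ)) t - weilIncrement (fun x ↦ ((|u x| : ℝ) : ℂ)) t)) =
      4 * ∫ x, max (-u x) 0 *
        ∫ t in Ioi (0 : ℝ), weilArchDensity t * (max (u (x + t)) 0 + max (u (x - t)) 0) ∧
    Integrable (fun x ↦ max (-u x) 0 *
        ∫ t in Ioi (0 : ℝ), weilArchDensity t * (max (u (x + t)) 0 + max (u (x - t)) 0)) := by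
  have hp2 := swg_memLp_posPart hu
  have hn2 := swg_memLp_negPart hu
  have hpm : Measurable fun x ↦ max (u x) 0 := hum.max measurable_const
  have hnm : Measurable fun x ↦ max (-u x) 0 := hum.neg.max measurable_const
  -- the integrand on `ℝ × ℝ`, variables `(t, x)`
  set Φ : ℝ × ℝ → ℝ := fun q ↦ (Ioi (0 : ℝ)).indicator weilArchDensity q.1 *
    (max (-u q.2) 0 * (max (u (q.2 + q.1)) 0 + max (u (q.2 - q.1)) 0)) with hΦ
  have hωm : Measurable fun t : ℝ ↦ (Ioi (0 : ℝ)).indicator weilArchDensity t :=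
    measurable_weilArchDensity.indicator measurableSet_Ioi
  have hω0 : ∀ t, 0 ≤ (Ioi (0 : ℝ)).indicator weilArchDensity t := fun t ↦ by
    by_cases ht : t ∈ Ioi (0 : ℝ)
    · rw [indicator_of_mem ht]; exact (weilArchDensity_pos ht).le
    · rw [indicator_of_notMem ht]
  have hΦm : Measurable Φ :=
    (hωm.comp measurable_fst).mul ((hnm.comp measurable_snd).mul
      ((hpm.comp (measurable_snd.add measurable_fst)).add (hpm.comp (measurable_snd.sub measurable_fst))))
  have hΦ0 : ∀ q, 0 ≤ Φ q := fun q ↦ mul_nonneg (hω0 _)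
    (mul_nonneg (le_max_right _ _) (add_nonneg (le_max_right _ _) (le_max_right _ _)))
  -- sections in `x` at fixed `t` are integrable (products of `L²` functions)
  have hsec : ∀ t, Integrable fun x ↦ max (-u x) 0 * (max (u (x + t)) 0 + max (u (x - t)) 0) := by
    intro t
    have h1 : Integrable fun x ↦ max (-u x) 0 * max (u (x + t)) 0 :=
      hn2.integrable_mul (hp2.comp_measurePreserving (measurePreserving_add_right volume t))
    have h2 : Integrable fun x ↦ max (-u x) 0 * max (u (x - t)) 0 :=
      hn2.integrable_mul (hp2.comp_measurePreserving (measurePreserving_sub_right volume t))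
    exact (h1.add h2).congr (Eventually.of_forall fun x ↦ by simp only [Pi.add_apply]; ring)
  have hsecΦ : ∀ t, Integrable fun x ↦ Φ (t, x) := fun t ↦ by
    simp only [hΦ]
    exact (hsec t).const_mul _
  -- the `t`-marginal of `‖Φ‖` is `𝟙_{t>0} w(t) (D_t u − D_t |u|)/4`
  have hmarg : ∀ t, ∫ x, ‖Φ (t, x)‖ = (Ioi (0 : ℝ)).indicator weilArchDensity t *
      ((weilIncrement (fun x ↦ ((u x : ℝ) : ℂ)) t - weilIncrement (fun x ↦ ((|u x| : ℝ) : ℂ)) t) / 4) := by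
    intro t
    have h1 : ∫ x, ‖Φ (t, x)‖ = ∫ x, Φ (t, x) :=
      integral_congr_ae (Eventually.of_forall fun x ↦ Real.norm_of_nonneg (hΦ0 _))
    rw [h1]
    simp only [hΦ]
    rw [integral_const_mul, swg_weilIncrement_sub_abs hu t]
    ring
  have hint : Integrable Φ (volume.prod volume) := by
    rw [integrable_prod_iff hΦm.aestronglyMeasurable]
    refine ⟨Eventually.of_forall hsecΦ, ?_⟩
    simp_rw [hmarg]
    have h := ((hE.sub hEA).div_const 4)
    have h' : IntegrableOn (fun t ↦ weilArchDensity t *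
        ((weilIncrement (fun x ↦ ((u x : ℝ) : ℂ)) t - weilIncrement (fun x ↦ ((|u x| : ℝ) : ℂ)) t) / 4))
        (Ioi 0) := h.congr (Eventually.of_forall fun t ↦ by simp only [Pi.sub_apply]; ring)
    have h'' := (integrable_indicator_iff measurableSet_Ioi).2 h'
    refine h''.congr (Eventually.of_forall fun t ↦ ?_)
    simp only
    by_cases ht : t ∈ Ioi (0 : ℝ)
    · rw [indicator_of_mem ht, indicator_of_mem ht]
    · rw [indicator_of_notMem ht, indicator_of_notMem ht, zero_mul]
  -- Fubini
  have hF1 : ∫ q, Φ q ∂(volume.prod volume) = ∫ t, ∫ x, Φ (t, x) := integral_prod Φ hint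
  have hF2 : ∫ q, Φ q ∂(volume.prod volume) = ∫ x, ∫ t, Φ (t, x) := integral_prod_symm Φ hint
  -- left side
  have hL : ∫ t, ∫ x, Φ (t, x) = (∫ t in Ioi (0 : ℝ), weilArchDensity t *
      (weilIncrement (fun x ↦ ((u x : ℝ) : ℂ)) t - weilIncrement (fun x ↦ ((|u x| : ℝ) : ℂ)) t)) / 4 := by
    have h1 : ∀ t, ∫ x, Φ (t, x) = (Ioi (0 : ℝ)).indicator weilArchDensity t *
        ((weilIncrement (fun x ↦ ((u x : ℝ) : ℂ)) t - weilIncrement (fun x ↦ ((|u x| : ℝ) : ℂ)) t) / 4) := by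
      intro t
      rw [← hmarg t]
      exact integral_congr_ae (Eventually.of_forall fun x ↦ (Real.norm_of_nonneg (hΦ0 _)).symm)
    simp_rw [h1]
    rw [← integral_indicator measurableSet_Ioi, ← integral_div]
    refine integral_congr_ae (Eventually.of_forall fun t ↦ ?_)
    simp only
    by_cases ht : t ∈ Ioi (0 : ℝ)
    · rw [indicator_of_mem ht, indicator_of_mem ht]; ring
    · rw [indicator_of_notMem ht, indicator_of_notMem ht, zero_mul, zero_div]
  -- right side
  have hR : ∫ x, ∫ t, Φ (t, x) = ∫ x, max (-u x) 0 *
      ∫ t in Ioi (0 : ℝ), weilArchDensity t * (max (u (x + t)) 0 + max (u (x - t)) 0) := by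
    refine integral_congr_ae (Eventually.of_forall fun x ↦ ?_)
    simp only [hΦ]
    rw [← integral_const_mul, ← integral_indicator measurableSet_Ioi]
    refine integral_congr_ae (Eventually.of_forall fun t ↦ ?_)
    simp only
    by_cases ht : t ∈ Ioi (0 : ℝ)
    · rw [indicator_of_mem ht, indicator_of_mem ht]; ring
    · rw [indicator_of_notMem ht, indicator_of_notMem ht, zero_mul]
  refine ⟨by linarith [hF1.symm.trans hF2, hL, hR], ?_⟩
  -- integrability of the `x`-marginal
  have hm := hint.integral_prod_right
  refine hm.congr (Eventually.of_forall fun x ↦ ?_)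
  simp only [hΦ]
  rw [← integral_const_mul, ← integral_indicator measurableSet_Ioi]
  refine integral_congr_ae (Eventually.of_forall fun t ↦ ?_)
  simp only
  by_cases ht : t ∈ Ioi (0 : ℝ)
  · rw [indicator_of_mem ht, indicator_of_mem ht]; ring
  · rw [indicator_of_notMem ht, indicator_of_notMem ht, zero_mul]

end Tonelli

/-! ## The ground-state source criterion -/

section Criterion

variable {u : ℝ → ℝ} {a : ℝ}

/-- **GROUND-STATE SOURCE CRITERION.**  Let `a > 0` and let `u : ℝ → ℝ` be measurable with
`IsWeilGroundState a u` (as a complex function).  If for a.e. `y` with `u(y) < 0`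
`S_u(y) = ∫_{(0,∞)} w(t)(u⁺(y+t)+u⁺(y−t)) dt + Σ_{log n<2a} Λ(n)n^{-1/2}(u⁺(y+log n)+u⁺(y−log n))
 − 2∫ u⁺(x)cosh((x−y)/2) dx > 0`, then `u ≥ 0` a.e. [folklore] -/
theorem swg_ae_nonneg_of_source_pos (ha : 0 < a) (hum : Measurable u)
    (hU : IsWeilGroundState a (fun x ↦ ((u x : ℝ) : ℂ)))
    (hsrc : ∀ᵐ y : ℝ, u y < 0 → 0 <
      (∫ t in Ioi (0 : ℝ), weilArchDensity t * (max (u (y + t)) 0 + max (u (y - t)) 0)) +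
      (∑ n ∈ weilPrimeIndex a, (Λ n : ℝ) / Real.sqrt n *
        (max (u (y + Real.log n)) 0 + max (u (y - Real.log n)) 0)) -
      2 * ∫ x, max (u x) 0 * Real.cosh ((x - y) / 2)) :
    ∀ᵐ y : ℝ, 0 ≤ u y := by
  set U : ℝ → ℂ := fun x ↦ ((u x : ℝ) : ℂ) with hUdef
  set A : ℝ → ℂ := fun x ↦ ((|u x| : ℝ) : ℂ) with hAdef
  have hU2 : MemLp U 2 volume := hU.memLp
  have hu2 : MemLp u 2 volume :=
    MemLp.of_le hU2 hum.aestronglyMeasurable (Eventually.of_forall fun x ↦ by simp [hUdef])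
  have hus : ∀ᵐ x : ℝ, x ∉ Icc (-a) a → u x = 0 := by
    filter_upwards [hU.ae_eq_zero_of_notMem] with x hx hxm
    have h := hx hxm
    simpa [hUdef] using h
  have hp2 := swg_memLp_posPart hu2
  have hn2 := swg_memLp_negPart hu2
  -- (C2) for `U`: finite energy and the bottom inequality
  obtain ⟨hE, hC2⟩ := stub_groundStateEnergy a U hU
  -- the modulus `A = |u|` has finite energy; (C1) for `A`
  have hAeq : (fun x ↦ ((‖U x‖ : ℝ) : ℂ)) = A := by
    funext x; simp [hUdef, hAdef]
  have hEA : IntegrableOn (fun t ↦ weilArchDensity t * weilIncrement A t) (Ioi 0) := by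
    have h := finiteEnergy_norm hU2 hE
    rwa [hAeq] at h
  have hAm : MemLp A 2 volume := by
    have h := memLp_ofReal_norm hU2
    rwa [hAeq] at h
  have hAs : ∀ᵐ x : ℝ, x ∉ Icc (-a) a → A x = 0 := by
    filter_upwards [hus] with x hx hxm
    simp [hAdef, hx hxm]
  have hC1 := stub_formDomainPos a ha A hAm hAs hEA
  have hNA : ∫ x, ‖A x‖ ^ 2 = ∫ x, ‖U x‖ ^ 2 :=
    integral_congr_ae (Eventually.of_forall fun x ↦ by simp [hAdef, hUdef])
  -- fold identities
  obtain ⟨harch, hIJ⟩ := swg_archGain_eq hum hu2 hE hEA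
  have hpol := swg_weilPoleForm_abs_sub_eq hu2 hus
  -- the prime part in source form
  have hsecℓ : ∀ ℓ : ℝ, Integrable fun x ↦ max (-u x) 0 * (max (u (x + ℓ)) 0 + max (u (x - ℓ)) 0) := by
    intro ℓ
    have h1 : Integrable fun x ↦ max (-u x) 0 * max (u (x + ℓ)) 0 :=
      hn2.integrable_mul (hp2.comp_measurePreserving (measurePreserving_add_right volume ℓ))
    have h2 : Integrable fun x ↦ max (-u x) 0 * max (u (x - ℓ)) 0 :=
      hn2.integrable_mul (hp2.comp_measurePreserving (measurePreserving_sub_right volume ℓ))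
    exact (h1.add h2).congr (Eventually.of_forall fun x ↦ by simp only [Pi.add_apply]; ring)
  have hprime : ∑ n ∈ weilPrimeIndex a, (Λ n : ℝ) / Real.sqrt n *
      (weilIncrement U (Real.log n) - weilIncrement A (Real.log n)) =
      4 * ∫ x, max (-u x) 0 * ∑ n ∈ weilPrimeIndex a, (Λ n : ℝ) / Real.sqrt n *
        (max (u (x + Real.log n)) 0 + max (u (x - Real.log n)) 0) := by
    have hterm : ∀ n ∈ weilPrimeIndex a, (Λ n : ℝ) / Real.sqrt n *
        (weilIncrement U (Real.log n) - weilIncrement A (Real.log n)) =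
        ∫ x, 4 * ((Λ n : ℝ) / Real.sqrt n *
          (max (-u x) 0 * (max (u (x + Real.log n)) 0 + max (u (x - Real.log n)) 0))) := by
      intro n _
      rw [swg_weilIncrement_sub_abs hu2 (Real.log n), ← integral_const_mul, ← integral_const_mul]
      refine integral_congr_ae (Eventually.of_forall fun x ↦ ?_); simp only; ring
    rw [Finset.sum_congr rfl hterm, ← integral_finsetSum _ (fun n _ ↦ ?_), ← integral_const_mul]
    · refine integral_congr_ae (Eventually.of_forall fun x ↦ ?_)
      simp only [Finset.mul_sum]
      exact Finset.sum_congr rfl fun n _ ↦ by ring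
    · exact ((hsecℓ (Real.log n)).const_mul _).const_mul _
  have hIP : Integrable fun x ↦ max (-u x) 0 * ∑ n ∈ weilPrimeIndex a, (Λ n : ℝ) / Real.sqrt n *
      (max (u (x + Real.log n)) 0 + max (u (x - Real.log n)) 0) := by
    have h := integrable_finsetSum (weilPrimeIndex a)
      (fun n _ ↦ ((hsecℓ (Real.log n)).const_mul ((Λ n : ℝ) / Real.sqrt n)))
    refine h.congr (Eventually.of_forall fun x ↦ ?_)
    simp only [Finset.mul_sum]
    exact Finset.sum_congr rfl fun n _ ↦ by ring
  -- the polar piece is integrable against `u⁻`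
  have hcosh : Continuous fun t : ℝ ↦ Real.cosh (t / 2) :=
    Real.continuous_cosh.comp (continuous_id.div_const 2)
  have hsinh : Continuous fun t : ℝ ↦ Real.sinh (t / 2) :=
    Real.continuous_sinh.comp (continuous_id.div_const 2)
  have hpi : Integrable fun x ↦ max (u x) 0 := swg_integrable_of_memLp hp2 (swg_posPart_ae_zero hus)
  have hni : Integrable fun x ↦ max (-u x) 0 := swg_integrable_of_memLp hn2 (swg_negPart_ae_zero hus)
  have hIC : Integrable fun y ↦ max (-u y) 0 * ∫ x, max (u x) 0 * Real.cosh ((x - y) / 2) := by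
    have ipc := swg_integrable_mul_continuous hpi (swg_posPart_ae_zero hus) hcosh
    have ips := swg_integrable_mul_continuous hpi (swg_posPart_ae_zero hus) hsinh
    have key : ∀ y, ∫ x, max (u x) 0 * Real.cosh ((x - y) / 2) =
        Real.cosh (y / 2) * (∫ x, max (u x) 0 * Real.cosh (x / 2)) -
          Real.sinh (y / 2) * ∫ x, max (u x) 0 * Real.sinh (x / 2) := by
      intro y
      have hpt : ∀ x, max (u x) 0 * Real.cosh ((x - y) / 2) =
          Real.cosh (y / 2) * (max (u x) 0 * Real.cosh (x / 2)) -
            Real.sinh (y / 2) * (max (u x) 0 * Real.sinh (x / 2)) := by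
        intro x; rw [show (x - y) / 2 = x / 2 - y / 2 by ring, Real.cosh_sub]; ring
      simp_rw [hpt]
      rw [integral_sub (ipc.const_mul _) (ips.const_mul _), integral_const_mul, integral_const_mul]
    simp_rw [key]
    have inc := swg_integrable_mul_continuous hni (swg_negPart_ae_zero hus) hcosh
    have ins := swg_integrable_mul_continuous hni (swg_negPart_ae_zero hus) hsinh
    have i3a : Integrable (fun y ↦ max (-u y) 0 * Real.cosh (y / 2) *
        ∫ x, max (u x) 0 * Real.cosh (x / 2)) := inc.mul_const _
    have i3b : Integrable (fun y ↦ max (-u y) 0 * Real.sinh (y / 2) *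
        ∫ x, max (u x) 0 * Real.sinh (x / 2)) := ins.mul_const _
    exact (i3a.sub i3b).congr (Eventually.of_forall fun y ↦ by simp only [Pi.sub_apply]; ring)
  -- the energy difference
  have hEdiff : weilDirichletEnergy a U - weilDirichletEnergy a A =
      (∑ n ∈ weilPrimeIndex a, (Λ n : ℝ) / Real.sqrt n *
        (weilIncrement U (Real.log n) - weilIncrement A (Real.log n))) +
      ∫ t in Ioi (0 : ℝ), weilArchDensity t * (weilIncrement U t - weilIncrement A t) := by
    have harchsub : ∫ t in Ioi (0 : ℝ), weilArchDensity t * (weilIncrement U t - weilIncrement A t) =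
        (∫ t in Ioi (0 : ℝ), weilArchDensity t * weilIncrement U t) -
          ∫ t in Ioi (0 : ℝ), weilArchDensity t * weilIncrement A t := by
      rw [← integral_sub hE hEA]
      refine integral_congr_ae (Eventually.of_forall fun t ↦ ?_); simp only; ring
    have hprimesub : ∑ n ∈ weilPrimeIndex a, (Λ n : ℝ) / Real.sqrt n *
        (weilIncrement U (Real.log n) - weilIncrement A (Real.log n)) =
        (∑ n ∈ weilPrimeIndex a, (Λ n : ℝ) / Real.sqrt n * weilIncrement U (Real.log n)) -
          ∑ n ∈ weilPrimeIndex a, (Λ n : ℝ) / Real.sqrt n * weilIncrement A (Real.log n) := by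
      rw [← Finset.sum_sub_distrib]
      exact Finset.sum_congr rfl fun n _ ↦ by ring
    unfold weilDirichletEnergy
    rw [harchsub, hprimesub]
    ring
  -- the source pairing
  set S : ℝ → ℝ := fun y ↦
    (∫ t in Ioi (0 : ℝ), weilArchDensity t * (max (u (y + t)) 0 + max (u (y - t)) 0)) +
      (∑ n ∈ weilPrimeIndex a, (Λ n : ℝ) / Real.sqrt n *
        (max (u (y + Real.log n)) 0 + max (u (y - Real.log n)) 0)) -
      2 * ∫ x, max (u x) 0 * Real.cosh ((x - y) / 2) with hSdef
  have hInS : Integrable fun y ↦ max (-u y) 0 * S y := by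
    refine ((hIJ.add hIP).sub (hIC.const_mul 2)).congr (Eventually.of_forall fun y ↦ ?_)
    simp only [Pi.add_apply, Pi.sub_apply, hSdef]
    ring
  have hsum : ∫ y, max (-u y) 0 * S y =
      (∫ y, max (-u y) 0 * ∫ t in Ioi (0 : ℝ), weilArchDensity t * (max (u (y + t)) 0 + max (u (y - t)) 0)) +
      (∫ y, max (-u y) 0 * ∑ n ∈ weilPrimeIndex a, (Λ n : ℝ) / Real.sqrt n *
        (max (u (y + Real.log n)) 0 + max (u (y - Real.log n)) 0)) -
      2 * ∫ y, max (-u y) 0 * ∫ x, max (u x) 0 * Real.cosh ((x - y) / 2) := by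
    have iA : Integrable (fun y ↦ max (-u y) 0 *
        (∫ t in Ioi (0 : ℝ), weilArchDensity t * (max (u (y + t)) 0 + max (u (y - t)) 0)) +
        max (-u y) 0 * ∑ n ∈ weilPrimeIndex a, (Λ n : ℝ) / Real.sqrt n *
          (max (u (y + Real.log n)) 0 + max (u (y - Real.log n)) 0)) := hIJ.add hIP
    have iC : Integrable (fun y ↦ 2 * (max (-u y) 0 * ∫ x, max (u x) 0 * Real.cosh ((x - y) / 2))) :=
      hIC.const_mul 2
    have e : (fun y ↦ max (-u y) 0 * S y) = fun y ↦
        (max (-u y) 0 * (∫ t in Ioi (0 : ℝ), weilArchDensity t * (max (u (y + t)) 0 + max (u (y - t)) 0)) +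
          max (-u y) 0 * ∑ n ∈ weilPrimeIndex a, (Λ n : ℝ) / Real.sqrt n *
            (max (u (y + Real.log n)) 0 + max (u (y - Real.log n)) 0)) -
        2 * (max (-u y) 0 * ∫ x, max (u x) 0 * Real.cosh ((x - y) / 2)) := by
      funext y; simp only [hSdef]; ring
    rw [e, integral_sub iA iC, integral_add hIJ hIP, integral_const_mul]
  -- the fold inequality: `∫ u⁻ S ≤ 0`
  have hle : ∫ y, max (-u y) 0 * S y ≤ 0 := by
    have h1 : weilPoleForm U + weilDirichletEnergy a U ≤ weilPoleForm A + weilDirichletEnergy a A := by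
      rw [hNA] at hC1; linarith
    have h2 : (weilPoleForm A + weilDirichletEnergy a A) - (weilPoleForm U + weilDirichletEnergy a U) =
        -4 * ∫ y, max (-u y) 0 * S y := by
      rw [hsum]
      linarith [hpol, hEdiff, hprime, harch]
    linarith
  -- non-negativity of the integrand, hence `u⁻ S = 0` a.e.
  have hnn : 0 ≤ᵐ[volume] fun y ↦ max (-u y) 0 * S y := by
    filter_upwards [hsrc] with y hy
    by_cases huy : u y < 0
    · exact mul_nonneg (le_max_right _ _) (hy huy).le
    · simp only [Pi.zero_apply]; rw [max_eq_right (by linarith), zero_mul]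
  have hzero : (fun y ↦ max (-u y) 0 * S y) =ᵐ[volume] 0 :=
    (integral_eq_zero_iff_of_nonneg_ae hnn hInS).1 (le_antisymm hle (integral_nonneg_of_ae hnn))
  filter_upwards [hzero, hsrc] with y hy0 hy
  by_contra hneg
  have huy : u y < 0 := lt_of_not_ge hneg
  have hS : 0 < S y := hy huy
  have hn : 0 < max (-u y) 0 := by rw [max_eq_left (by linarith)]; linarith
  have : max (-u y) 0 * S y = 0 := hy0
  nlinarith

/-- **`GSP a` from a source-positive real ground state**: under the hypotheses of
`swg_ae_nonneg_of_source_pos`, the window `a` carries a ground state of the FULL windowed Weil form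
that is real and `≥ 0` a.e. (namely `u` itself). [folklore] -/
theorem swg_GSP_of_source_pos (ha : 0 < a) (hum : Measurable u)
    (hU : IsWeilGroundState a (fun x ↦ ((u x : ℝ) : ℂ)))
    (hsrc : ∀ᵐ y : ℝ, u y < 0 → 0 <
      (∫ t in Ioi (0 : ℝ), weilArchDensity t * (max (u (y + t)) 0 + max (u (y - t)) 0)) +
      (∑ n ∈ weilPrimeIndex a, (Λ n : ℝ) / Real.sqrt n *
        (max (u (y + Real.log n)) 0 + max (u (y - Real.log n)) 0)) -
      2 * ∫ x, max (u x) 0 * Real.cosh ((x - y) / 2)) :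
    ∃ v : ℝ → ℂ, IsWeilGroundState a v ∧ ∀ᵐ t : ℝ, (v t).im = 0 ∧ 0 ≤ (v t).re :=
  ⟨fun x ↦ ((u x : ℝ) : ℂ), hU, (swg_ae_nonneg_of_source_pos ha hum hU hsrc).mono fun t ht ↦
    ⟨Complex.ofReal_im _, by simpa using ht⟩⟩

end Criterion

end Summit.RiemannHypothesis.RiemannHypothesis.Theorems.PolarPerronFrobenius

end
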